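import Summits.ABC.IUTFork.Cor312PilotIdelesMInclusion
import Summits.ABC.IUTFork.Cor312HullLicenceLabelZero
import HarnessLib

/-!
# [IUTchIII] Cor. 3.12 — the M-LEVEL twin: branch C's hull-level S_H at the PINNED q-reading IS the (xi-f) licence at abc-iut-s2-p8's
# summand-route sharp setting `settingPrVolSharpM` (`‖t_q‖ ≤ 1`; every REALISING q-idele; the M books' genuine q-ideles `tqM`)

PROOF-ONLY file (D-0012; 0 definitions, 0 `Prop` facts, no instance, no notation) of the abc-iut cell (branch C certificate seat
abc-iut-C-cert-2, gen 5; row «C:K-SH-IFF-LICENCE», M twin of `Cor312HullLicenceLabelZero`, p485141). TAKES NO SIDE on [IUTchIII] Cor. 3.12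
(kurims manuscript p. 173–174; Step (xi-f) p. 184 l. 26–29) or on the reading (U)/(P); «iff by theorem», nothing about `ABC`.

The M books of branch C (`Conditional.abc_of_SH_v11M_window_szpiroBadAll` p453767, the M (U) Szpiro-bad / content books, …) carry the
antecedent `S_H := Cor312Vol.PilotKummerCompatHull (LatticeSituation.ofShells (logShellsOfInitialDH D logv) …) (settingPrVolSharpM D …)
(fun _ => qRegion) qK` — the hull clause at EVERY label `j ∈ {0,…,l⋇}`; abc-iut-c312-1's `Thm311ToCor312.Licence` is the same at the labels of
`𝔽_l^⋇`. At abc-iut-s2-p8's `settingPrVolSharpM` (M-level presentation `presAtM` of the genuine completions `K_{v̲}`, [IUTchI] Def. 3.1 (e)) the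
label-`0` Θ-box over a finite rational place `u` is `e⁻¹(Π_{v⃗} ι(1)·(R_I)^∼)` (`PadicPresentation.labelIdele_zero`) and the q-box is
`e⁻¹(Π_{v⃗} ι(t_{q,v̲_0})·(R_I)^∼)` (abc-iut-w4-d036 `qRegion_settingPrVolSharpM_non` / `thetaRegion_settingPrVolSharpM_non`), so the label-`0`
cell holds as soon as `‖t_{q,x}‖ ≤ 1` (same slot, nested translates: w4-d036 `iota_smul_normalizedPacket_subset_of_norm_le_slot`); at `∞` both
regions are everything. Every REALISING q-idele has `log ‖t_q‖ ≤ 0` (w4-d036 `log_norm_qIdele_nonpos_of_realisesM`), in particular abc-iut-w5-d166's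
genuine `tqM D p u hu r x` for ANY idele data `r` (`log_norm_tqM`).

* §1 `qRegion_subset_thetaRegion_settingPrVolSharpM_zero_non` / `…_zero` · `thetaRegion_subset_thetaHull_settingPrVolSharpM` ·
  `qRegion_subset_thetaHull_settingPrVolSharpM_zero`.
* §2 **`pilotKummerCompatHull_settingPrVolSharpM_iff_licence`** (ANY initial Θ-datum `D`, ANY context/column binders, ANY `qK`, ANY `Sq`/`htq1`,
  Θ-ideles `t ≠ 0`, q-ideles with `‖t_q‖ ≤ 1`) · `…_of_realisesM` · **`pilotKummerCompatHull_settingPrVolSharpM_tqM_iff_licence`** (the M books'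
  genuine q-ideles `fun u x => tqM D (ratChar u) u (natCast_ratChar_mem u) r x`, ANY `r : IdeleData D` — the books take `r := ideleDataOf D hI`).

HONEST SCOPE: identities between OUR typed predicates; no binder of any certificate is discharged; the per-label sharp M licence is a
STRONGER-THAN-PRINT reading; decided-as-typed ≠ in print; typed ≠ proved (this: proved).
[cite: Mochizuki2012, IUTchIII Cor. 3.12 p. 173–174, Step (xi-d) p. 183, Step (xi-f) p. 184; IUTchI Def. 3.1 (b)(c)(e) p. 61–62]
[cite: DupuyHilado2025, §3.3, §3.4, §3.7, §3.9] [claim: Mochizuki2012, status: disputed] for every IUT sentence quoted.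
-/

noncomputable section

open Set Function NumberField IsDedekindDomain
open scoped Pointwise

namespace Summit.ABC.IUTFork.Thm311.Real

open Cor312 Cor312.Setting Cor312Vol Literature.IUT.LogThetaLattice Literature.IUT.LogVolume Literature.IUT.HodgeTheaters
variable {F K Fbar : Type} [Field F] [NumberField F] [Field K] [NumberField K] [Algebra F K]
  [Field Fbar] [Algebra F Fbar] [Algebra K Fbar] {E : WeierstrassCurve F} [E.IsElliptic] {l : ℕ}
  {Pb : BadPlacePredicates K} (D : InitialThetaData F K Fbar E l Pb) {logvK : PadicLogsVal K}
  (hlog : LogvAnalyticVal logvK)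
  (M : Type) [Field M] [NumberField M]
  (archPk : ∀ (j : (thetaIndexOfInitial D).Label) (vQ : (thetaIndexOfInitial D).VQ),
    Set ((logShellsOfInitialDH D logvK).Packet j vQ))
  (archSub : ∀ (j : (thetaIndexOfInitial D).Label) (v : (thetaIndexOfInitial D).V),
    Set ((logShellsOfInitialDH D logvK).Packet j ((thetaIndexOfInitial D).over v)))
  (Ψ : ℤ → ∀ v : (thetaIndexOfInitial D).V, v ∈ (thetaIndexOfInitial D).Vbad →
    Set ((logShellsOfInitialDH D logvK).StarPacket v))
  (act : ℤ → ∀ v : (thetaIndexOfInitial D).V, v ∈ (thetaIndexOfInitial D).Vbad →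
    (logShellsOfInitialDH D logvK).StarPacket v → Module.End ℚ ((logShellsOfInitialDH D logvK).StarPacket v))
  (Mmod : ℤ → ∀ j : (thetaIndexOfInitial D).LabelStar, Set ((logShellsOfInitialDH D logvK).GlobalPacket j.1))
  (region : ℤ → ∀ j : (thetaIndexOfInitial D).LabelStar, FinDivisor M → ∀ vQ : (thetaIndexOfInitial D).VQ,
    Set ((logShellsOfInitialDH D logvK).Packet j.1 vQ))
  (n : ℤ) {HT : Type} {LogLink : HT → HT → Type} {IsFull : ∀ {s t : HT}, LogLink s t → Prop}
  (lat : LGPGaussianLogThetaLattice LogLink IsFull)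
  {Frd : Type} {IsoF : Frd → Frd → Type} {Ob : Frd → Type} {realify : Frd → Frd} {Strip : Type}
  {IsoS : Strip → Strip → Type} {Mv : ∀ v : (thetaIndexOfInitial D).V, v ∈ (thetaIndexOfInitial D).Vbad → Type}
  [∀ v h, Monoid (Mv v h)]
  (sig : GlobalLGPFrobenioidSignature (thetaIndexOfInitial D).lstar (thetaIndexOfInitial D).V
    (· ∈ (thetaIndexOfInitial D).Vbad) Frd IsoF Ob realify Strip IsoS Mv)
  (split : SplittingMonoids Mv) {ObΔ : Type} {N : ∀ v : (thetaIndexOfInitial D).V, v ∈ (thetaIndexOfInitial D).Vbad → Type}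
  [∀ v h, Monoid (N v h)] (qData : QPilotData ObΔ N)
  (t : ∀ (u : FinitePlace ℚ) (_ : Fin (thetaIndexOfInitial D).lstar) (x : (thetaIndexOfInitial D).Fibre (Val.non u)),
    kOfM D (ratChar u) u (natCast_ratChar_mem u) x)
  (tq : ∀ (u : FinitePlace ℚ) (x : (thetaIndexOfInitial D).Fibre (Val.non u)),
    kOfM D (ratChar u) u (natCast_ratChar_mem u) x)
  (htq0 : ∀ u x, tq u x ≠ 0) (Sq : Finset (FinitePlace ℚ))
  (htq1 : ∀ (u : FinitePlace ℚ) (x : (thetaIndexOfInitial D).Fibre (Val.non u)), u ∉ Sq → ‖tq u x‖ = 1)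

/-! ## §1. The label-`0` cell at `settingPrVolSharpM` -/

/-- **q-region ⊆ every Kummer image of the Θ-pilot at the label `0` over a finite rational place**, when `‖t_{q,x}‖ ≤ 1` at every member
of the fibre: the Θ-box there is `ι(1)·(R_I)^∼` in each summand (`labelIdele … 0 = 1`), the q-box `ι(t_{q,v̲_0})·(R_I)^∼` (same slot).
[cite: DupuyHilado2025, §3.7, §3.9] [cite: Mochizuki2012, IUTchIV Prop. 1.4 (i) p. 13] -/
theorem qRegion_subset_thetaRegion_settingPrVolSharpM_zero_non (m : ℤ) (u : FinitePlace ℚ)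
    (hle : ∀ x : (thetaIndexOfInitial D).Fibre (Val.non u), ‖tq u x‖ ≤ 1) :
    (settingPrVolSharpM D hlog t tq M archPk archSub Ψ act Mmod region n lat sig split qData htq0 Sq htq1).qRegion 0 (Val.non u) ⊆
      (settingPrVolSharpM D hlog t tq M archPk archSub Ψ act Mmod region n lat sig split qData htq0 Sq htq1).thetaRegion m 0
        (Val.non u) := by
  rw [thetaRegion_settingPrVolSharpM_non, qRegion_settingPrVolSharpM_non]
  refine Set.preimage_mono (Set.pi_mono fun e _ => ?_)
  show iota (ratChar u) ((presAtM D hlog u).kk e) (Fin.last _) (tq u (e (Fin.last _))) •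
      (normalizedPacket (ratChar u) ((presAtM D hlog u).kk e) : Set ((presAtM D hlog u).X e)) ⊆
    iota (ratChar u) ((presAtM D hlog u).kk e) (Fin.last _) ((presAtM D hlog u).labelIdele (t u) 0 (e (Fin.last _))) •
      (normalizedPacket (ratChar u) ((presAtM D hlog u).kk e) : Set ((presAtM D hlog u).X e))
  rw [PadicPresentation.labelIdele_zero]
  exact iota_smul_normalizedPacket_subset_of_norm_le_slot (ratChar u) _ (Fin.last _) one_ne_zero
    ((hle _).trans_eq norm_one.symm)

/-- The same at every `v_ℚ` (at `∞` every Kummer image is the whole packet). [cite: DupuyHilado2025, §3.7, §3.9] -/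
theorem qRegion_subset_thetaRegion_settingPrVolSharpM_zero (m : ℤ) (hle : ∀ u x, ‖tq u x‖ ≤ 1) :
    ∀ vQ : (thetaIndexOfInitial D).VQ,
      (settingPrVolSharpM D hlog t tq M archPk archSub Ψ act Mmod region n lat sig split qData htq0 Sq htq1).qRegion 0 vQ ⊆
        (settingPrVolSharpM D hlog t tq M archPk archSub Ψ act Mmod region n lat sig split qData htq0 Sq htq1).thetaRegion m 0 vQ
  | .inl w => (Set.subset_univ _).trans_eq (thetaRegion_settingPrVolSharpM_arc D hlog M archPk archSub Ψ act Mmod region n lat sig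
      split qData t tq htq0 Sq htq1 m 0 w).symm
  | .inr u => qRegion_subset_thetaRegion_settingPrVolSharpM_zero_non D hlog M archPk archSub Ψ act Mmod region n lat sig split qData t
      tq htq0 Sq htq1 m u (hle u)

/-- Every Kummer image of the Θ-pilot lies in the packet hull `ⁿ˒°𝒰_{j,v_ℚ}` of the union of the possible images (the frame's
`subset_hull` on the (Ind3)-union; generic). [cite: Mochizuki2012, IUTchIII Rmk. 3.9.5 (i) p. 127] [claim: Mochizuki2012, status: disputed] -/
theorem thetaRegion_subset_thetaHull_settingPrVolSharpM (m : ℤ) (j : (thetaIndexOfInitial D).Label)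
    (vQ : (thetaIndexOfInitial D).VQ) :
    (settingPrVolSharpM D hlog t tq M archPk archSub Ψ act Mmod region n lat sig split qData htq0 Sq htq1).thetaRegion m j vQ ⊆
      (settingPrVolSharpM D hlog t tq M archPk archSub Ψ act Mmod region n lat sig split qData htq0 Sq htq1).thetaHull j vQ :=
  fun _ hx => ((settingPrVolSharpM D hlog t tq M archPk archSub Ψ act Mmod region n lat sig split qData htq0 Sq htq1).frame j
      vQ).subset_hull _
    ((settingPrVolSharpM D hlog t tq M archPk archSub Ψ act Mmod region n lat sig split qData htq0 Sq
        htq1).thetaRegion3_subset_sUnion j vQ (Set.mem_iUnion.mpr ⟨m, hx⟩))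

/-- **The label-`0` cell at `settingPrVolSharpM`**: `‖t_q‖ ≤ 1` everywhere ⟹ `qRegion 0 v_ℚ ⊆ ⁿ˒°𝒰_{0,v_ℚ}` at every `v_ℚ`.
[cite: Mochizuki2012, IUTchIII Cor. 3.12 Step (xi-f) p. 184] [cite: DupuyHilado2025, §3.9] [claim: Mochizuki2012, status: disputed] -/
theorem qRegion_subset_thetaHull_settingPrVolSharpM_zero (hle : ∀ u x, ‖tq u x‖ ≤ 1) (vQ : (thetaIndexOfInitial D).VQ) :
    (settingPrVolSharpM D hlog t tq M archPk archSub Ψ act Mmod region n lat sig split qData htq0 Sq htq1).qRegion 0 vQ ⊆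
      (settingPrVolSharpM D hlog t tq M archPk archSub Ψ act Mmod region n lat sig split qData htq0 Sq htq1).thetaHull 0 vQ :=
  (qRegion_subset_thetaRegion_settingPrVolSharpM_zero D hlog M archPk archSub Ψ act Mmod region n lat sig split qData t tq htq0 Sq
      htq1 0 hle vQ).trans
    (thetaRegion_subset_thetaHull_settingPrVolSharpM D hlog M archPk archSub Ψ act Mmod region n lat sig split qData t tq htq0 Sq
      htq1 0 0 vQ)

/-! ## §2. S_H (pinned reading) ⟺ the (xi-f) licence at `settingPrVolSharpM` -/

variable (frobAdm : ℤ → ℤ → ∀ (j : (thetaIndexOfInitial D).Label) (vQ : (thetaIndexOfInitial D).VQ),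
    Set ((logShellsOfInitialDH D logvK).Packet j vQ) → Prop)
  (frobLogvol : ℤ → ℤ → ∀ (j : (thetaIndexOfInitial D).Label) (vQ : (thetaIndexOfInitial D).VQ),
    Set ((logShellsOfInitialDH D logvK).Packet j vQ) → ℝ)
  (frobΨ : ℤ → ℤ → ∀ v : (thetaIndexOfInitial D).V, v ∈ (thetaIndexOfInitial D).Vbad →
    Set ((logShellsOfInitialDH D logvK).StarPacket v))
  (frobMmod : ℤ → ℤ → ∀ j : (thetaIndexOfInitial D).LabelStar, Set ((logShellsOfInitialDH D logvK).GlobalPacket j.1))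
  (unitImage : ℤ → ℤ → ℕ → ∀ (j : (thetaIndexOfInitial D).Label) (vQ : (thetaIndexOfInitial D).VQ),
    Set ((logShellsOfInitialDH D logvK).Packet j vQ))
  (ballImage : ℤ → ℤ → ∀ (j : (thetaIndexOfInitial D).Label) (vQ : (thetaIndexOfInitial D).VQ),
    Set ((logShellsOfInitialDH D logvK).Packet j vQ))
  (thetaDiv : ℤ → ℤ → LgpDivisor M (thetaIndexOfInitial D).lstar)
  (qK : ∀ v : (thetaIndexOfInitial D).V, v ∈ (thetaIndexOfInitial D).Vbad → Set ((logShellsOfInitialDH D logvK).StarPacket v))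

/-- **S_H (pinned reading) ⟺ the (xi-f) LICENCE at the M-level summand-route sharp setting**, for ANY initial Θ-datum, ANY context and
column binders, ANY q-datum `qK`, ANY `Sq`, Θ-ideles and q-ideles with `‖t_q‖ ≤ 1`: the M books' antecedent
`PilotKummerCompatHull (LatticeSituation.ofShells …) (settingPrVolSharpM …) (fun _ => qRegion) qK` and `Thm311ToCor312.Licence (settingPrVolSharpM …)`
are ONE predicate. [cite: Mochizuki2012, IUTchIII Cor. 3.12 Step (xi-d) p. 183, (xi-f) p. 184] [cite: DupuyHilado2025, §3.9]
[claim: Mochizuki2012, status: disputed] -/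
theorem pilotKummerCompatHull_settingPrVolSharpM_iff_licence (hle : ∀ u x, ‖tq u x‖ ≤ 1) :
    Cor312Vol.PilotKummerCompatHull
        (LatticeSituation.ofShells (logShellsOfInitialDH D logvK) M archPk archSub (summandPiecesPrM D hlog).Adm
          (summandPiecesPrM D hlog).logvol Ψ act Mmod region frobAdm frobLogvol frobΨ frobMmod unitImage ballImage thetaDiv)
        (settingPrVolSharpM D hlog t tq M archPk archSub Ψ act Mmod region n lat sig split qData htq0 Sq htq1)
        (fun _ => (settingPrVolSharpM D hlog t tq M archPk archSub Ψ act Mmod region n lat sig split qData htq0 Sq htq1).qRegion)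
        qK ↔
      Thm311ToCor312.Licence
        (settingPrVolSharpM D hlog t tq M archPk archSub Ψ act Mmod region n lat sig split qData htq0 Sq htq1) :=
  Cor312Vol.pilotKummerCompatHull_qRegion_iff_licence_of_label_zero _ _ qK
    (qRegion_subset_thetaHull_settingPrVolSharpM_zero D hlog M archPk archSub Ψ act Mmod region n lat sig split qData t tq htq0 Sq
      htq1 hle)

/-- **The same for REALISING q-ideles** (`log ‖t_{q,x}‖ = −P_q(v(x))·ln N(v(x))/n_{v(x)}` for `P_q` of `pilotData D`; then `‖t_q‖ ≤ 1`,
abc-iut-w4-d036 `log_norm_qIdele_nonpos_of_realisesM`). [cite: Mochizuki2012, IUTchIII Cor. 3.12 Step (xi-f) p. 184; IUTchI Def. 3.1 (b)(c)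
p. 61–62] [cite: DupuyHilado2025, §3.3, §3.4, §3.9] [claim: Mochizuki2012, status: disputed] -/
theorem pilotKummerCompatHull_settingPrVolSharpM_iff_licence_of_realisesM
    (htq : ∀ (u : FinitePlace ℚ) (x : (thetaIndexOfInitial D).Fibre (Val.non u)),
      Real.log ‖tq u x‖ = -((ThetaData.pilotData D).qPilot (placeModOfM D u x)) * logNorm (fieldOfModuli E) (placeModOfM D u x) /
        localDegree (fieldOfModuli E) (placeModOfM D u x)) :
    Cor312Vol.PilotKummerCompatHull
        (LatticeSituation.ofShells (logShellsOfInitialDH D logvK) M archPk archSub (summandPiecesPrM D hlog).Adm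
          (summandPiecesPrM D hlog).logvol Ψ act Mmod region frobAdm frobLogvol frobΨ frobMmod unitImage ballImage thetaDiv)
        (settingPrVolSharpM D hlog t tq M archPk archSub Ψ act Mmod region n lat sig split qData htq0 Sq htq1)
        (fun _ => (settingPrVolSharpM D hlog t tq M archPk archSub Ψ act Mmod region n lat sig split qData htq0 Sq htq1).qRegion)
        qK ↔
      Thm311ToCor312.Licence
        (settingPrVolSharpM D hlog t tq M archPk archSub Ψ act Mmod region n lat sig split qData htq0 Sq htq1) :=
  pilotKummerCompatHull_settingPrVolSharpM_iff_licence D hlog M archPk archSub Ψ act Mmod region n lat sig split qData t tq htq0 Sq htq1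
    frobAdm frobLogvol frobΨ frobMmod unitImage ballImage thetaDiv qK fun u x =>
      (Real.log_nonpos_iff (norm_nonneg _)).mp (log_norm_qIdele_nonpos_of_realisesM D tq htq u x)

end Summit.ABC.IUTFork.Thm311.Real

/-! ## §3. The M books' genuine q-ideles `tqM` (any idele data `r`) -/

namespace Summit.ABC.IUTFork.Thm311.Real

open Cor312 Cor312.Setting Cor312Vol Literature.IUT.LogThetaLattice Literature.IUT.LogVolume Literature.IUT.HodgeTheaters
variable {F K Fbar : Type} [Field F] [NumberField F] [Field K] [NumberField K] [Algebra F K]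
  [Field Fbar] [Algebra F Fbar] [Algebra K Fbar] {E : WeierstrassCurve F} [E.IsElliptic] {l : ℕ}
  {Pb : BadPlacePredicates K} (D : InitialThetaData F K Fbar E l Pb) {logvK : PadicLogsVal K}
  (hlog : LogvAnalyticVal logvK)
  (M : Type) [Field M] [NumberField M]
  (archPk : ∀ (j : (thetaIndexOfInitial D).Label) (vQ : (thetaIndexOfInitial D).VQ),
    Set ((logShellsOfInitialDH D logvK).Packet j vQ))
  (archSub : ∀ (j : (thetaIndexOfInitial D).Label) (v : (thetaIndexOfInitial D).V),
    Set ((logShellsOfInitialDH D logvK).Packet j ((thetaIndexOfInitial D).over v)))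
  (Ψ : ℤ → ∀ v : (thetaIndexOfInitial D).V, v ∈ (thetaIndexOfInitial D).Vbad →
    Set ((logShellsOfInitialDH D logvK).StarPacket v))
  (act : ℤ → ∀ v : (thetaIndexOfInitial D).V, v ∈ (thetaIndexOfInitial D).Vbad →
    (logShellsOfInitialDH D logvK).StarPacket v → Module.End ℚ ((logShellsOfInitialDH D logvK).StarPacket v))
  (Mmod : ℤ → ∀ j : (thetaIndexOfInitial D).LabelStar, Set ((logShellsOfInitialDH D logvK).GlobalPacket j.1))
  (region : ℤ → ∀ j : (thetaIndexOfInitial D).LabelStar, FinDivisor M → ∀ vQ : (thetaIndexOfInitial D).VQ,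
    Set ((logShellsOfInitialDH D logvK).Packet j.1 vQ))
  (n : ℤ) {HT : Type} {LogLink : HT → HT → Type} {IsFull : ∀ {s t : HT}, LogLink s t → Prop}
  (lat : LGPGaussianLogThetaLattice LogLink IsFull)
  {Frd : Type} {IsoF : Frd → Frd → Type} {Ob : Frd → Type} {realify : Frd → Frd} {Strip : Type}
  {IsoS : Strip → Strip → Type} {Mv : ∀ v : (thetaIndexOfInitial D).V, v ∈ (thetaIndexOfInitial D).Vbad → Type}
  [∀ v h, Monoid (Mv v h)]
  (sig : GlobalLGPFrobenioidSignature (thetaIndexOfInitial D).lstar (thetaIndexOfInitial D).V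
    (· ∈ (thetaIndexOfInitial D).Vbad) Frd IsoF Ob realify Strip IsoS Mv)
  (split : SplittingMonoids Mv) {ObΔ : Type} {N : ∀ v : (thetaIndexOfInitial D).V, v ∈ (thetaIndexOfInitial D).Vbad → Type}
  [∀ v h, Monoid (N v h)] (qData : QPilotData ObΔ N)
  (t : ∀ (u : FinitePlace ℚ) (_ : Fin (thetaIndexOfInitial D).lstar) (x : (thetaIndexOfInitial D).Fibre (Val.non u)),
    kOfM D (ratChar u) u (natCast_ratChar_mem u) x)
  (r : ThetaData.IdeleData D) (Sq : Finset (FinitePlace ℚ))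
  (htq1 : ∀ (u : FinitePlace ℚ) (x : (thetaIndexOfInitial D).Fibre (Val.non u)), u ∉ Sq →
    ‖tqM D (ratChar u) u (natCast_ratChar_mem u) r x‖ = 1)
  (frobAdm : ℤ → ℤ → ∀ (j : (thetaIndexOfInitial D).Label) (vQ : (thetaIndexOfInitial D).VQ),
    Set ((logShellsOfInitialDH D logvK).Packet j vQ) → Prop)
  (frobLogvol : ℤ → ℤ → ∀ (j : (thetaIndexOfInitial D).Label) (vQ : (thetaIndexOfInitial D).VQ),
    Set ((logShellsOfInitialDH D logvK).Packet j vQ) → ℝ)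
  (frobΨ : ℤ → ℤ → ∀ v : (thetaIndexOfInitial D).V, v ∈ (thetaIndexOfInitial D).Vbad →
    Set ((logShellsOfInitialDH D logvK).StarPacket v))
  (frobMmod : ℤ → ℤ → ∀ j : (thetaIndexOfInitial D).LabelStar, Set ((logShellsOfInitialDH D logvK).GlobalPacket j.1))
  (unitImage : ℤ → ℤ → ℕ → ∀ (j : (thetaIndexOfInitial D).Label) (vQ : (thetaIndexOfInitial D).VQ),
    Set ((logShellsOfInitialDH D logvK).Packet j vQ))
  (ballImage : ℤ → ℤ → ∀ (j : (thetaIndexOfInitial D).Label) (vQ : (thetaIndexOfInitial D).VQ),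
    Set ((logShellsOfInitialDH D logvK).Packet j vQ))
  (thetaDiv : ℤ → ℤ → LgpDivisor M (thetaIndexOfInitial D).lstar)
  (qK : ∀ v : (thetaIndexOfInitial D).V, v ∈ (thetaIndexOfInitial D).Vbad → Set ((logShellsOfInitialDH D logvK).StarPacket v))

/-- The M books' genuine q-ideles `tqM` have norm `≤ 1` (abc-iut-w5-d166 `log_norm_tqM`: they REALISE `P_q`). [cite: DupuyHilado2025, §3.4, §3.9]
[cite: Mochizuki2012, IUTchI Def. 3.1 (b)(c)(e) p. 61–62] -/
theorem norm_tqM_le_one (u : FinitePlace ℚ) (x : (thetaIndexOfInitial D).Fibre (Val.non u)) :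
    ‖tqM D (ratChar u) u (natCast_ratChar_mem u) r x‖ ≤ 1 :=
  (Real.log_nonpos_iff (norm_nonneg _)).mp
    (log_norm_qIdele_nonpos_of_realisesM D (fun u x => tqM D (ratChar u) u (natCast_ratChar_mem u) r x)
      (fun u x => log_norm_tqM D (ratChar u) u (natCast_ratChar_mem u) r x) u x)

/-- **THE M LINE: S_H (pinned reading) ⟺ the (xi-f) LICENCE** at `settingPrVolSharpM` with the M books' genuine q-ideles
`fun u x => tqM D (ratChar u) u (natCast_ratChar_mem u) r x` (ANY idele data `r` — the books take `r := ideleDataOf D hI` —, ANY Θ-ideles,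
ANY `Sq`/`htq1`, ANY context/column binders, ANY `qK`, ANY degree). [cite: Mochizuki2012, IUTchIII Cor. 3.12 Step (xi-f) p. 184]
[cite: DupuyHilado2025, §3.9] [claim: Mochizuki2012, status: disputed] -/
theorem pilotKummerCompatHull_settingPrVolSharpM_tqM_iff_licence :
    Cor312Vol.PilotKummerCompatHull
        (LatticeSituation.ofShells (logShellsOfInitialDH D logvK) M archPk archSub (summandPiecesPrM D hlog).Adm
          (summandPiecesPrM D hlog).logvol Ψ act Mmod region frobAdm frobLogvol frobΨ frobMmod unitImage ballImage thetaDiv)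
        (settingPrVolSharpM D hlog t (fun u x => tqM D (ratChar u) u (natCast_ratChar_mem u) r x) M archPk archSub Ψ act Mmod region n
          lat sig split qData (fun u x => tqM_ne_zero D (ratChar u) u (natCast_ratChar_mem u) r x) Sq htq1)
        (fun _ => (settingPrVolSharpM D hlog t (fun u x => tqM D (ratChar u) u (natCast_ratChar_mem u) r x) M archPk archSub Ψ act Mmod
          region n lat sig split qData (fun u x => tqM_ne_zero D (ratChar u) u (natCast_ratChar_mem u) r x) Sq htq1).qRegion)
        qK ↔
      Thm311ToCor312.Licence
        (settingPrVolSharpM D hlog t (fun u x => tqM D (ratChar u) u (natCast_ratChar_mem u) r x) M archPk archSub Ψ act Mmod region n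
          lat sig split qData (fun u x => tqM_ne_zero D (ratChar u) u (natCast_ratChar_mem u) r x) Sq htq1) :=
  pilotKummerCompatHull_settingPrVolSharpM_iff_licence D hlog M archPk archSub Ψ act Mmod region n lat sig split qData t
    (fun u x => tqM D (ratChar u) u (natCast_ratChar_mem u) r x) (fun u x => tqM_ne_zero D (ratChar u) u (natCast_ratChar_mem u) r x)
    Sq htq1 frobAdm frobLogvol frobΨ frobMmod unitImage ballImage thetaDiv qK (norm_tqM_le_one D r)

end Summit.ABC.IUTFork.Thm311.Real

end
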